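import Literature.Barriers.Parity.SiegelZeroPrimePairsChiSumsSieve
import Literature.NumberTheory.Sieve.BetaSieveMainTermSigned
import Literature.NumberTheory.Sieve.BetaSieveErrorSums
import Literature.NumberTheory.LFunctions.EulerProductZetaTwoTail
import HarnessLib

/-!
# Matomäki–Merikoski Lemma 2.4, main term: `(π²/6) ∑_{d ∣ P(z)} λ_d λ_L(d)/d = (1 + O(R + 1/z)) ∏_{p<z} (1 − 1/p)⁻¹` (§6, end)

Sibling of `SiegelZeroPrimePairsChiSumsSieve.lean`. Everything in this file is PROVED. It carries out
the last step of §6 of Matomäki–Merikoski (arXiv:2112.11412, proof of Lemma 2.4): "The sum equals (by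
Lemma 3.2 (ii)) `= (1 + O_A(e^{−Auθ/2})) ∏_{p<z} (1 + 1/p)`, so that the main term is
`F'(1) ∏_{p<z}(1 + 1/p) = ∏_{p<z}(1 + 1/p) ∏_p ((1 + 1/p)(1 − 1/p))⁻¹ = (1 + O(1/z)) ∏_{p<z} (1 − 1/p)⁻¹`",
with `F'(1) = ζ(2) = π²/6`, in the structural form

  `|(π²/6) ∑_{d ∣ P(z)} μ(d)χ⁺(d) λ_L(d)/d − V(z)| ≤ V(z) (e^{4/z} R + (e^{4/z} − 1))`,
  `V(z) = ∏_{p<z} (1 − 1/p)⁻¹`,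

where `R` is the error sum of `BetaSieve.abs_sum_weights_mul_sub_vprod_le` (Lemma 3.2 (ii)) for the
multiplicative function `g(d) = λ_L(d)/d` (`g(p) = −1/p`), and `e^{4/z}` is the tail of the Euler product
of `ζ(2)` (`EulerProductTwo.tail_bounds_real`).

* `MatomakiMerikoski.liouville_pdiv_id_apply` / `isMultiplicative_liouville_pdiv_id` / `liouville_pdiv_id_prime` —
  the arithmetic function `λ_L(n)/n` (Mathlib `pdiv` of `λ_L` and `id`), multiplicative, `= −1/p` at primes;
* `MatomakiMerikoski.primeFactors_siftingProd_eq` — `P(z)` has prime factors `Nat.primesBelow ⌈z⌉₊`;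
* `MatomakiMerikoski.abs_main_term_sub_le` — the displayed bound.

## References

* K. Matomäki, J. Merikoski, IMRN 2023 (arXiv:2112.11412), §6 (last two displays).
  [cite: MatomakiMerikoski2023, §6]
-/

noncomputable section

open Finset Real ArithmeticFunction
open scoped ArithmeticFunction.Moebius

namespace Literature.Barriers.Parity.MatomakiMerikoski

open Literature.NumberTheory.Sieve Literature.NumberTheory.Sieve.BetaSieve
  Literature.NumberTheory.LFunctions

/-! ### The multiplicative function `λ_L(n)/n` -/

/-- `g(n) = λ_L(n)/n`, as the pointwise quotient of Mathlib's arithmetic functions `λ_L` and `id`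
(no new definition: `pdiv`). [folklore] -/
theorem liouville_pdiv_id_apply (n : ℕ) :
    (((liouville : ArithmeticFunction ℤ) : ArithmeticFunction ℝ).pdiv
      ((ArithmeticFunction.id : ArithmeticFunction ℕ) : ArithmeticFunction ℝ)) n = (liouville n : ℝ) / n := by
  rw [ArithmeticFunction.pdiv_apply, ArithmeticFunction.intCoe_apply, ArithmeticFunction.natCoe_apply,
    ArithmeticFunction.id_apply]

/-- `λ_L(n)/n` is multiplicative. [folklore] -/
theorem isMultiplicative_liouville_pdiv_id :
    (((liouville : ArithmeticFunction ℤ) : ArithmeticFunction ℝ).pdiv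
      ((ArithmeticFunction.id : ArithmeticFunction ℕ) : ArithmeticFunction ℝ)).IsMultiplicative :=
  ArithmeticFunction.isMultiplicative_liouville.intCast.pdiv ArithmeticFunction.isMultiplicative_id.natCast

/-- `λ_L(p)/p = −1/p` at a prime. [folklore] -/
theorem liouville_pdiv_id_prime {p : ℕ} (hp : p.Prime) :
    (((liouville : ArithmeticFunction ℤ) : ArithmeticFunction ℝ).pdiv
      ((ArithmeticFunction.id : ArithmeticFunction ℕ) : ArithmeticFunction ℝ)) p = -1 / p := by
  rw [liouville_pdiv_id_apply, ArithmeticFunction.liouville_apply hp.ne_zero,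
    ArithmeticFunction.cardFactors_apply_prime hp]
  simp

/-! ### The sifting range -/

/-- `P(z) = ∏_{p < z, p ∤ 1} p` has prime factors exactly `Nat.primesBelow ⌈z⌉₊`. [folklore] -/
theorem primeFactors_siftingProd_eq (z : ℝ) :
    (∏ p ∈ (Nat.primesBelow ⌈z⌉₊).filter (fun p : ℕ => ¬ p ∣ 1), p).primeFactors = Nat.primesBelow ⌈z⌉₊ := by
  ext p
  rw [mem_primeFactors_siftingProd, Nat.mem_primesBelow, Nat.lt_ceil]
  tauto

/-! ### The main term -/

/-- **Main term of Lemma 2.4** (§6, last step; `F'(1) = ζ(2) = π²/6`). Let `β > 1`, `1 < z`, `1 < D`,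
`β log z ≤ log D`, `A : ℕ`, `P = P(z)`, `λ_d = μ(d)χ⁺(d)` the upper `β`-sieve weights and
`V(z) = ∏_{p<z} (1 − 1/p)⁻¹`. Then
`|(π²/6) ∑_{d ∣ P} λ_d λ_L(d)/d − V(z)| ≤ V(z) · (e^{4/z} R + (e^{4/z} − 1))`, where
`R = ∑_{1 ≤ r ≤ ω(P), log D < (r+β) log z} 2^{−Ar} ∏_{p ∣ P, p ≥ z^{θ^r}} (1 + 4/p)(1 + 2^{A+1}/p)` is the
error of Lemma 3.2 (ii) for `g(d) = λ_L(d)/d` and `e^{4/z} ≥ (π²/6)∏_{p<z}(1 − p⁻²) ≥ 1` bounds the tail of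
the Euler product of `ζ(2)`. [cite: MatomakiMerikoski2023, §6 (last two displays)] -/
theorem abs_main_term_sub_le {β D z : ℝ} (hβ : 1 < β) (hz : 1 < z) (hD1 : 1 < D)
    (hzD : β * Real.log z ≤ Real.log D) (A : ℕ) :
    |π ^ 2 / 6 * ∑ d ∈ (∏ p ∈ (Nat.primesBelow ⌈z⌉₊).filter (fun p : ℕ => ¬ p ∣ 1), p).divisors,
        (μ d : ℝ) * ind 1 β D d * (liouville d : ℝ) / d -
      ∏ p ∈ Nat.primesBelow ⌈z⌉₊, (1 - (p : ℝ)⁻¹)⁻¹| ≤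
      (∏ p ∈ Nat.primesBelow ⌈z⌉₊, (1 - (p : ℝ)⁻¹)⁻¹) *
        (Real.exp (4 / z) * ∑ r ∈ Icc 1 (Nat.primesBelow ⌈z⌉₊).card,
          (if Real.log D < ((r : ℕ) + β) * Real.log z then
            (∏ p ∈ (Nat.primesBelow ⌈z⌉₊).filter (fun p : ℕ => z ^ ((1 - 1 / β) ^ r) ≤ (p : ℝ)),
              ((1 + 4 / (p : ℝ)) * (1 + 2 ^ (A + 1) / (p : ℝ)))) / 2 ^ (A * r) else 0) +
          (Real.exp (4 / z) - 1)) := by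
  set P : ℕ := ∏ p ∈ (Nat.primesBelow ⌈z⌉₊).filter (fun p : ℕ => ¬ p ∣ 1), p with hP
  have hPsq : Squarefree P := squarefree_prod_primesBelow_filter z 1
  have hPf : P.primeFactors = Nat.primesBelow ⌈z⌉₊ := primeFactors_siftingProd_eq z
  have hprime : ∀ p ∈ Nat.primesBelow ⌈z⌉₊, p.Prime := fun p hp => Nat.prime_of_mem_primesBelow hp
  have hpz : ∀ p ∈ P.primeFactors, (p : ℝ) < z := fun p hp =>
    (mem_primeFactors_siftingProd.mp hp).2
  -- Lemma 3.2 (ii) for `g = λ_L/id`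
  set g : ArithmeticFunction ℝ := ((liouville : ArithmeticFunction ℤ) : ArithmeticFunction ℝ).pdiv
      ((ArithmeticFunction.id : ArithmeticFunction ℕ) : ArithmeticFunction ℝ) with hg
  have hgp : ∀ p ∈ P.primeFactors, |g p| ≤ 2 / p ∧ g p ≤ 1 / 2 := by
    intro p hp
    have hpp := Nat.prime_of_mem_primeFactors hp
    have hp2 : (2 : ℝ) ≤ p := by exact_mod_cast hpp.two_le
    rw [hg, liouville_pdiv_id_prime hpp]
    constructor
    · rw [abs_div, abs_neg, abs_one, abs_of_pos (by linarith : (0 : ℝ) < p)]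
      exact div_le_div_of_nonneg_right (by norm_num) (by linarith)
    · have : -1 / (p : ℝ) ≤ 0 := div_nonpos_of_nonpos_of_nonneg (by norm_num) (by linarith)
      linarith
  have hii := abs_sum_weights_mul_sub_vprod_le hβ hz hD1 hzD isMultiplicative_liouville_pdiv_id hPsq hpz hgp A
  -- identify: the sum, `vprod = ∏_{p<z} (1 + 1/p)`
  have hsum : ∑ d ∈ P.divisors, (μ d : ℝ) * ind 1 β D d * (liouville d : ℝ) / d =
      ∑ d ∈ P.divisors, (μ d : ℝ) * ind 1 β D d * g d := by
    refine Finset.sum_congr rfl fun d _ => ?_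
    rw [hg, liouville_pdiv_id_apply]; ring
  have hvprod : vprod g P = ∏ p ∈ Nat.primesBelow ⌈z⌉₊, (1 + (p : ℝ)⁻¹) := by
    rw [vprod, hPf]
    refine Finset.prod_congr rfl fun p hp => ?_
    rw [hg, liouville_pdiv_id_prime (hprime p hp)]
    ring
  rw [hPf, hvprod] at hii
  -- the Euler product identity and tail
  set Vplus := ∏ p ∈ Nat.primesBelow ⌈z⌉₊, (1 + (p : ℝ)⁻¹) with hVplus
  set V := ∏ p ∈ Nat.primesBelow ⌈z⌉₊, (1 - (p : ℝ)⁻¹)⁻¹ with hV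
  set T := π ^ 2 / 6 * ∏ p ∈ Nat.primesBelow ⌈z⌉₊, (1 - ((p : ℝ) ^ 2)⁻¹) with hT
  set S := ∑ d ∈ P.divisors, (μ d : ℝ) * ind 1 β D d * g d with hS
  set R := ∑ r ∈ Icc 1 (Nat.primesBelow ⌈z⌉₊).card,
    (if Real.log D < ((r : ℕ) + β) * Real.log z then
      (∏ p ∈ (Nat.primesBelow ⌈z⌉₊).filter (fun p : ℕ => z ^ ((1 - 1 / β) ^ r) ≤ (p : ℝ)),
        ((1 + 4 / (p : ℝ)) * (1 + 2 ^ (A + 1) / (p : ℝ)))) / 2 ^ (A * r) else 0) with hR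
  have hEuler : π ^ 2 / 6 * Vplus = T * V := EulerProductTwo.mul_prod_one_add_inv_eq hprime
  obtain ⟨hT1, hTexp⟩ := EulerProductTwo.tail_bounds_real hz.le
  have hV0 : 0 ≤ V := Finset.prod_nonneg fun p hp => by
    have hp2 : (2 : ℝ) ≤ p := by exact_mod_cast (hprime p hp).two_le
    have : (p : ℝ)⁻¹ ≤ 1 / 2 := by rw [inv_eq_one_div]; exact div_le_div_of_nonneg_left (by norm_num) (by norm_num) hp2
    exact inv_nonneg.mpr (by linarith)
  have hVplus0 : 0 ≤ Vplus := Finset.prod_nonneg fun p _ => by positivity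
  have hR0 : 0 ≤ R := Finset.sum_nonneg fun r _ => by
    split_ifs
    · exact div_nonneg (Finset.prod_nonneg fun p _ => by positivity) (by positivity)
    · exact le_rfl
  rw [hsum]
  -- `(π²/6) S − V = (π²/6)(S − Vplus) + (T − 1) V`
  have hsplit : π ^ 2 / 6 * S - V = π ^ 2 / 6 * (S - Vplus) + (T - 1) * V := by
    have : π ^ 2 / 6 * Vplus = T * V := hEuler
    linear_combination this
  rw [hsplit]
  have h1 : |π ^ 2 / 6 * (S - Vplus)| ≤ V * (Real.exp (4 / z) * R) := by
    rw [abs_mul, abs_of_pos (by positivity : (0 : ℝ) < π ^ 2 / 6)]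
    calc π ^ 2 / 6 * |S - Vplus| ≤ π ^ 2 / 6 * (Vplus * R) :=
          mul_le_mul_of_nonneg_left hii (by positivity)
      _ = T * V * R := by rw [← mul_assoc, hEuler]
      _ ≤ Real.exp (4 / z) * V * R := by
          refine mul_le_mul_of_nonneg_right (mul_le_mul_of_nonneg_right hTexp hV0) hR0
      _ = V * (Real.exp (4 / z) * R) := by ring
  have h2 : |(T - 1) * V| ≤ V * (Real.exp (4 / z) - 1) := by
    rw [abs_mul, abs_of_nonneg (by linarith : 0 ≤ T - 1), abs_of_nonneg hV0]
    nlinarith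
  calc |π ^ 2 / 6 * (S - Vplus) + (T - 1) * V| ≤ |π ^ 2 / 6 * (S - Vplus)| + |(T - 1) * V| := abs_add_le _ _
    _ ≤ V * (Real.exp (4 / z) * R) + V * (Real.exp (4 / z) - 1) := add_le_add h1 h2
    _ = V * (Real.exp (4 / z) * R + (Real.exp (4 / z) - 1)) := by ring

end Literature.Barriers.Parity.MatomakiMerikoski
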